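import Summits.QuantumFields.BalabanUV.T4Continuum.Support.NE7FramedEqualsStrippedGauged
import Summits.QuantumFields.BalabanUV.T4Continuum.Support.NE7TorusChartDecoding
import Summits.QuantumFields.BalabanUV.T4Continuum.Support.NE7AdmissibleFibreLHC
import Summits.QuantumFields.BalabanUV.T4Continuum.Support.NE7EtaMinimiserGaugeCovariance
import Summits.QuantumFields.BalabanUV.T4Continuum.Support.AveragingDeficitMultiLevelFermat
import Summits.QuantumFields.BalabanUV.T4Continuum.Support.AveragingDeficitKDatum
import Summits.QuantumFields.BalabanUV.T4Continuum.Support.NE3ResidualSliceRep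
import HarnessLib

/-!
# NE7StrippedConstraintMap — THE STRIPPED (DOUBLE-BAR) CONSTRAINT MAP IN THE CHARTS AND ITS REDUCED OBJECTIVE: `Ψ(Φ) := skewPR(log(V₀⁻¹·(U̿^{j+1}(Φ)·V₀)))`, `Ψ(0) = 0`, and
# `minAct(chart_{V₀}(levelQ(chart_{U♯}Φ))) = minAct(chart_{V₀}(Ψ Φ))` FOR `Φ` NEAR `0` — the hypothesis `m∘G = m∘Ψ` of H3 ✓ `NE7StrippedConstraintSocket`, modulo two regime letters
# (lineage `b2b-balaban-t4-ne7-p1`, gen 119, file H6 = ROAD-G119 §5 S1)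

Cell `pub-balaban`, rung (B)+1 sub-cell t4, CRUX PROVER NE7 #1 (OWNER of row NE7), generation 119.
Over H5 ✓ `NE7FramedEqualsStrippedGauged` ([Balaban1985Averaging] (92)/(97) for the tree's chart: `cavgIter (j+1) (chart_{U♯}Φ) = (U̿^{j+1}(Φ)·V₀)^{v_{j+1}(Φ)}`, and `minAct` of both sides agree for a
unitary `N`-periodic frame), the decoding ✓ `NE7TorusChartDecoding.chart_skewPR_relLog_eq`, and the tree's regularity of the framed average of a chart point near `0`
(✓ `AveragingDeficitFermat.eventually_smallField_chart`, ✓ `AveragingDeficitMultiLevelPrep.cavgIter_unitary_small`, ✓ `AveragingDeficitMultiLevelFermat.continuousAt_cavgIter_chart`).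
WHAT ([folklore]; 2 defs, 0 sorry; general `d`): `strippedCfg L j U♯ Φ := dbavgCovIter L U♯ (relPert U♯ Φ̃) (j+1) · cavgIter L (j+1) U♯` (the `(j+1)`-fold double-bar average (90)–(91) of the chart
point times the datum `V₀ = cavgIter (j+1) U♯`); `strippedConstraint L N j U♯ Φ := skewPR N (relLog N V₀ (strippedCfg …Φ))` (its `𝔲(n)` chart coordinate at `V₀` on the top torus — THE `Ψ` OF
ROAD-G119 §2); `strippedCfg_zero`, `strippedConstraint_zero`; **`eventually_chart_levelQ_eq_cavgIter`** (decoding of the framed constraint near `0`: `chart_{V₀}(G Φ) =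
cavgIter (j+1) (chart_{U♯}Φ)`, PROVED); **`reduced_objective_eq_stripped`**: under the two DISPLAYED regime letters near `0` — (F) the accumulated frame `v_{j+1}(Φ)` is unitary and `N`-periodic,
(S) the stripped configuration is bondwise within `1∕4` of `V₀` on the top torus — `minAct(chart_{V₀}(levelQ L N j U♯ (chart_{U♯}Φ))) = minAct(chart_{V₀}(strippedConstraint … Φ))` eventually.
(F) and (S) hold in the regime of [Balaban1985Averaging] Prop. 4 (✓ `B8Prop7AdmittedFamily.dbavgCovIter_vcov_mem_unitaryUnits`, `Spine/NE3/FrameNormalisationAdmissibleTop.vcov_add_period`, and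
continuity of `Φ ↦ U̿^{j+1}(Φ)` from ✓ `B12Ineq417Regular.analyticOnNhd_logCovIter_ins`) — successor S1′.
HONEST FRAMING (page 1): bookkeeping over landed kernel theorems; (F), (S) are HYPOTHESES here; nothing of Bałaban's asserted ((88)–(92), (97) context only); NOT (G′), NOT NE7 as a spine node;
spine 0∕9; finite T⁴ rung (B)+1 — NOT infinite volume, NOT mass gap, NOT BetaPertH, NOT Clay.
-/

set_option autoImplicit false

open scoped BigOperators Matrix Matrix.Norms.L2Operator Topology
open Filter

namespace Summit.QuantumFields.BalabanUV.T4Continuum.NE7StrippedConstraintMap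

open Literature.MathematicalPhysics.QuantumFieldTheory.Balaban1983to89
open B7Prop1Explicit B7Prop2Explicit
open B7Eq92Concrete (dbavgCovIter vcov)
open T4AveragingDeficitWall (IsUnitaryCfg SmallField)
open T4AveragingDeficitWallBoundary (IsPeriodicCfg)
open AveragingDeficitTorusChart (TDir chart chartDir chart_zero isUnitaryCfg_chart isPeriodicCfg_chart)
open AveragingDeficitChartCalculus (relLog relLog_self)
open AveragingDeficitFermat (eventually_smallField_chart)
open AveragingDeficitTwoLevelPrep (skewSub skewPR)
open AveragingDeficitMultiLevelPrep (tower cavgIter levelQ LevelSmall tower_ne_zero natCast_tower_succ cavgIter_unitary_small isPeriodicCfg_cavgIter)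
open AveragingDeficitMultiLevelBridge (tower_eq)
open AveragingDeficitMultiLevelFermat (continuousAt_cavgIter_chart)
open AveragingDeficitKDatum (gaugeAct_inv_gaugeAct isUnitaryCfg_gaugeAct)
open MinimalActionSandwich (minAct)
open MinimalActionRate (sfClass SmallField.mono)
open NE3EnergyShapes (IsUnitarySite IsPeriodicSite)
open NE3.PairLandauB8Avg (relPert relPert_zero dbavgCovIter_one_right)
open NE7AdmissibleFibreLHC (chart_id_eq_chart_skewP)
open NE7TorusChartDecoding (chart_skewPR_relLog_eq)
open NE7EtaMinimiserGaugeCovariance (isUnitarySite_inv isPeriodicSite_inv)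
open NE3ResidualSliceRep (isPeriodicCfg_gaugeAct)
open NE7FramedEqualsStrippedGauged (cavgIter_chart_eq_gaugeAct_stripped minAct_cavgIter_chart_eq_stripped)

noncomputable section

variable {d : ℕ} {n : Type} [Fintype n] [DecidableEq n]

/-- **THE STRIPPED CONFIGURATION**: the `(j+1)`-fold double-bar average (90)–(91) of the chart point `chart_{U♯}Φ` (left perturbation `relPert U♯ Φ̃`) relative to the background tower of `U♯`, times the
averaged background `V₀ = cavgIter L (j+1) U♯`. [cite: Balaban1985Averaging, (90)–(92) p.31] -/
def strippedCfg (L j : ℕ) {M : ℕ} [NeZero M] (Us : Site d → Fin d → (Matrix n n ℂ)ˣ) (Φ : TDir d n M) : Site d → Fin d → (Matrix n n ℂ)ˣ :=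
  dbavgCovIter L Us (relPert Us (chartDir (ContinuousLinearMap.id ℝ (Matrix n n ℂ)) M Φ)) (j + 1) * cavgIter L (j + 1) Us

/-- **THE STRIPPED CONSTRAINT MAP IN THE CHARTS** (`Ψ` of ROAD-G119 §2): the `𝔲(n)` chart coordinate at `V₀ = cavgIter L (j+1) U♯`, on the top torus `[0,N)^d`, of the stripped configuration.
[folklore] -/
def strippedConstraint (L N j : ℕ) [NeZero L] [NeZero N] (Us : Site d → Fin d → (Matrix n n ℂ)ˣ)
    (Φ : ↥(skewSub d n (L * tower L N j))) : ↥(skewSub d n N) :=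
  haveI : NeZero (L * tower L N j) := ⟨Nat.mul_ne_zero (NeZero.ne L) (tower_ne_zero L N j)⟩
  skewPR N (relLog N (cavgIter L (j + 1) Us) (strippedCfg L j Us (Φ : TDir d n (L * tower L N j))))

/-- At `Φ = 0` the stripped configuration is the datum `V₀`. [folklore] -/
theorem strippedCfg_zero (L j : ℕ) {M : ℕ} [NeZero M] (Us : Site d → Fin d → (Matrix n n ℂ)ˣ) :
    strippedCfg L j Us (0 : TDir d n M) = cavgIter L (j + 1) Us := by
  unfold strippedCfg
  have h0 : chartDir (ContinuousLinearMap.id ℝ (Matrix n n ℂ)) M (0 : TDir d n M) = fun (_ : Site d) (_ : Fin d) => (0 : Matrix n n ℂ) := by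
    funext x κ; simp [chartDir]
  rw [h0, relPert_zero, dbavgCovIter_one_right, one_mul]

/-- `Ψ(0) = 0`. [folklore] -/
theorem strippedConstraint_zero (L N j : ℕ) [NeZero L] [NeZero N] (Us : Site d → Fin d → (Matrix n n ℂ)ˣ) :
    strippedConstraint L N j Us 0 = 0 := by
  unfold strippedConstraint
  simp only [Submodule.coe_zero, strippedCfg_zero, relLog_self, map_zero]

/-- **DECODING THE FRAMED CONSTRAINT NEAR `0`** (PROVED, no displayed letter): for `L ≥ 1`, a unitary `(L·tower L N j)`-periodic `U♯` with `SmallField U♯ a`, `a < x`, `0 ≤ x`, `LevelSmall d L j x`,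
eventually as `Φ → 0` in `skewSub (L·tower L N j)`: `chart_{V₀}(levelQ L N j U♯ (chart_{U♯}Φ)) = cavgIter L (j+1) (chart_{U♯}Φ)`, and the right side is unitary and `N`-periodic. [folklore] -/
theorem eventually_chart_levelQ_eq_cavgIter [Nonempty n] {L N : ℕ} [NeZero L] [NeZero N] (hL : 1 ≤ L) (j : ℕ)
    {Us : Site d → Fin d → (Matrix n n ℂ)ˣ} {a x : ℝ} (hUu : IsUnitaryCfg Us) (hUP : IsPeriodicCfg Us ((L : ℤ) * (tower L N j : ℕ)))
    (hUa : SmallField Us a) (hax : a < x) (hx : 0 ≤ x) (hs : LevelSmall d L j x) :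
    ∀ᶠ Φ : ↥(skewSub d n (L * tower L N j)) in 𝓝 0,
      chart (ContinuousLinearMap.id ℝ (Matrix n n ℂ)) N (cavgIter L (j + 1) Us)
          ((levelQ L N j Us (chart (ContinuousLinearMap.id ℝ (Matrix n n ℂ)) (L * tower L N j) Us (Φ : TDir d n (L * tower L N j)))) : TDir d n N)
        = cavgIter L (j + 1) (chart (ContinuousLinearMap.id ℝ (Matrix n n ℂ)) (L * tower L N j) Us (Φ : TDir d n (L * tower L N j))) ∧
      IsUnitaryCfg (cavgIter L (j + 1) (chart (ContinuousLinearMap.id ℝ (Matrix n n ℂ)) (L * tower L N j) Us (Φ : TDir d n (L * tower L N j)))) ∧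
      IsPeriodicCfg (cavgIter L (j + 1) (chart (ContinuousLinearMap.id ℝ (Matrix n n ℂ)) (L * tower L N j) Us (Φ : TDir d n (L * tower L N j)))) (N : ℤ) := by
  haveI : NeZero (L * tower L N j) := ⟨Nat.mul_ne_zero (NeZero.ne L) (tower_ne_zero L N j)⟩
  set M : ℕ := L * tower L N j with hM
  set V₀ := cavgIter L (j + 1) Us with hV₀
  have hUx : SmallField Us x := SmallField.mono hUa hax.le
  have eM : ((M : ℕ) : ℤ) = (L : ℤ) * (tower L N j : ℕ) := by rw [hM]; push_cast; ring
  have hUPM : IsPeriodicCfg Us ((M : ℕ) : ℤ) := by rw [eM]; exact hUP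
  have hUPt : IsPeriodicCfg Us ((tower L N (j + 1) : ℕ) : ℤ) := by rw [natCast_tower_succ]; exact hUP
  have hV₀u : IsUnitaryCfg V₀ := (cavgIter_unitary_small hL j hUu hx hs hUx).1
  have hV₀P : IsPeriodicCfg V₀ (N : ℤ) := isPeriodicCfg_cavgIter L N (j + 1) hUPt
  -- pull the two `TDir`-eventualities back along the inclusion of `skewSub`
  have hι : Tendsto (fun Φ : ↥(skewSub d n M) => (Φ : TDir d n M)) (𝓝 0) (𝓝 0) := by
    have h := (skewSub d n M).subtypeL.continuous.tendsto (0 : ↥(skewSub d n M))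
    rw [map_zero] at h
    exact h
  have hsmall : ∀ᶠ Φ : ↥(skewSub d n M) in 𝓝 0, SmallField (chart (ContinuousLinearMap.id ℝ (Matrix n n ℂ)) M Us (Φ : TDir d n M)) x :=
    hι.eventually (eventually_smallField_chart (ContinuousLinearMap.id ℝ (Matrix n n ℂ)) M hUPM hax hUa)
  have hnear : ∀ᶠ Φ : ↥(skewSub d n M) in 𝓝 0, ∀ rκ : (Fin d → Fin N) × Fin d,
      ‖(((V₀ (boxVec N rκ.1) rκ.2)⁻¹ : (Matrix n n ℂ)ˣ) : Matrix n n ℂ)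
        * (cavgIter L (j + 1) (chart (ContinuousLinearMap.id ℝ (Matrix n n ℂ)) M Us (Φ : TDir d n M)) (boxVec N rκ.1) rκ.2 : Matrix n n ℂ) - 1‖ ≤ 1 / 4 := by
    refine Filter.eventually_all.mpr fun rκ => ?_
    have hc0 := continuousAt_cavgIter_chart (d := d) (n := n) hL N j (ContinuousLinearMap.id ℝ (Matrix n n ℂ)) hUu hUP hx hs hUx (boxVec N rκ.1) rκ.2
    have hc : ContinuousAt (fun Φ : TDir d n M => ‖(((V₀ (boxVec N rκ.1) rκ.2)⁻¹ : (Matrix n n ℂ)ˣ) : Matrix n n ℂ)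
        * (cavgIter L (j + 1) (chart (ContinuousLinearMap.id ℝ (Matrix n n ℂ)) M Us Φ) (boxVec N rκ.1) rκ.2 : Matrix n n ℂ) - 1‖) 0 :=
      ((continuousAt_const.mul hc0).sub continuousAt_const).norm
    have h0 : ‖(((V₀ (boxVec N rκ.1) rκ.2)⁻¹ : (Matrix n n ℂ)ˣ) : Matrix n n ℂ)
        * (cavgIter L (j + 1) (chart (ContinuousLinearMap.id ℝ (Matrix n n ℂ)) M Us 0) (boxVec N rκ.1) rκ.2 : Matrix n n ℂ) - 1‖ < 1 / 4 := by
      rw [chart_zero, ← hV₀, Units.inv_mul, sub_self, norm_zero]; norm_num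
    exact (hι.eventually (hc.eventually (gt_mem_nhds h0))).mono fun Φ hΦ => hΦ.le
  filter_upwards [hsmall, hnear] with Φ hΦx hΦnear
  have hchu : IsUnitaryCfg (chart (ContinuousLinearMap.id ℝ (Matrix n n ℂ)) M Us (Φ : TDir d n M)) := by
    rw [chart_id_eq_chart_skewP Us Φ.2]; exact isUnitaryCfg_chart M hUu _
  have hchP : IsPeriodicCfg (chart (ContinuousLinearMap.id ℝ (Matrix n n ℂ)) M Us (Φ : TDir d n M)) ((tower L N (j + 1) : ℕ) : ℤ) := by
    have h := isPeriodicCfg_chart (ContinuousLinearMap.id ℝ (Matrix n n ℂ)) M hUPM (Φ : TDir d n M)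
    rw [eM, ← natCast_tower_succ] at h
    exact h
  have hWu : IsUnitaryCfg (cavgIter L (j + 1) (chart (ContinuousLinearMap.id ℝ (Matrix n n ℂ)) M Us (Φ : TDir d n M))) :=
    (cavgIter_unitary_small hL j hchu hx hs hΦx).1
  have hWP : IsPeriodicCfg (cavgIter L (j + 1) (chart (ContinuousLinearMap.id ℝ (Matrix n n ℂ)) M Us (Φ : TDir d n M))) (N : ℤ) :=
    isPeriodicCfg_cavgIter L N (j + 1) hchP
  refine ⟨?_, hWu, hWP⟩
  exact chart_skewPR_relLog_eq hV₀u hWu hV₀P hWP fun r κ => hΦnear (r, κ)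

/-- **THE REDUCED OBJECTIVE OF THE FRAMED CONSTRAINT IS THAT OF THE STRIPPED CONSTRAINT** (see the module docstring): eventually as `Φ → 0`,
`minAct(chart_{V₀}(levelQ L N j U♯ (chart_{U♯}Φ))) = minAct(chart_{V₀}(strippedConstraint L N j U♯ Φ))`, under the regime letters (F) and (S). [folklore] -/
theorem reduced_objective_eq_stripped [Nonempty n] {L N : ℕ} [NeZero L] [NeZero N] (hL : 1 ≤ L) {ε : ℝ} (hε : 0 ≤ ε) (j : ℕ)
    (hsε : LevelSmall d L j (ε / ((L : ℝ) ^ (j + 1)) ^ 2))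
    {Us : Site d → Fin d → (Matrix n n ℂ)ˣ} {a x : ℝ} (hUu : IsUnitaryCfg Us) (hUP : IsPeriodicCfg Us ((L : ℤ) * (tower L N j : ℕ)))
    (hUa : SmallField Us a) (hax : a < x) (hx : 0 ≤ x) (hs : LevelSmall d L j x)
    (hF : ∀ᶠ Φ : ↥(skewSub d n (L * tower L N j)) in 𝓝 0,
      IsUnitarySite (vcov L Us (relPert Us (chartDir (ContinuousLinearMap.id ℝ (Matrix n n ℂ)) (L * tower L N j) (Φ : TDir d n (L * tower L N j)))) (j + 1)) ∧
      IsPeriodicSite (vcov L Us (relPert Us (chartDir (ContinuousLinearMap.id ℝ (Matrix n n ℂ)) (L * tower L N j) (Φ : TDir d n (L * tower L N j)))) (j + 1)) (N : ℤ))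
    (hS : ∀ᶠ Φ : ↥(skewSub d n (L * tower L N j)) in 𝓝 0, ∀ (r : Fin d → Fin N) (κ : Fin d),
      ‖((((cavgIter L (j + 1) Us) (boxVec N r) κ)⁻¹ : (Matrix n n ℂ)ˣ) : Matrix n n ℂ)
        * (strippedCfg L j Us (Φ : TDir d n (L * tower L N j)) (boxVec N r) κ : Matrix n n ℂ) - 1‖ ≤ 1 / 4) :
    ∀ᶠ Φ : ↥(skewSub d n (L * tower L N j)) in 𝓝 0,
      minAct d (sfClass d L N ε) L N (j + 1) (chart (ContinuousLinearMap.id ℝ (Matrix n n ℂ)) N (cavgIter L (j + 1) Us)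
          ((levelQ L N j Us (chart (ContinuousLinearMap.id ℝ (Matrix n n ℂ)) (L * tower L N j) Us (Φ : TDir d n (L * tower L N j)))) : TDir d n N))
        = minAct d (sfClass d L N ε) L N (j + 1) (chart (ContinuousLinearMap.id ℝ (Matrix n n ℂ)) N (cavgIter L (j + 1) Us)
          ((strippedConstraint L N j Us Φ : ↥(skewSub d n N)) : TDir d n N)) := by
  haveI : NeZero (L * tower L N j) := ⟨Nat.mul_ne_zero (NeZero.ne L) (tower_ne_zero L N j)⟩
  set M : ℕ := L * tower L N j with hM
  set V₀ := cavgIter L (j + 1) Us with hV₀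
  have hUx : SmallField Us x := SmallField.mono hUa hax.le
  have hUPt : IsPeriodicCfg Us ((tower L N (j + 1) : ℕ) : ℤ) := by rw [natCast_tower_succ]; exact hUP
  have hV₀u : IsUnitaryCfg V₀ := (cavgIter_unitary_small hL j hUu hx hs hUx).1
  have hV₀P : IsPeriodicCfg V₀ (N : ℤ) := isPeriodicCfg_cavgIter L N (j + 1) hUPt
  filter_upwards [eventually_chart_levelQ_eq_cavgIter (N := N) hL j hUu hUP hUa hax hx hs, hF, hS] with Φ hG hFΦ hSΦ
  obtain ⟨hdecG, hWu, hWP⟩ := hG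
  obtain ⟨hvU, hvP⟩ := hFΦ
  -- the stripped configuration is a gauge transform of the framed average: unitary and periodic
  have hfac := cavgIter_chart_eq_gaugeAct_stripped L j Us (Φ : TDir d n M)
  have hWS : strippedCfg L j Us (Φ : TDir d n M)
      = gaugeAct (fun z => (vcov L Us (relPert Us (chartDir (ContinuousLinearMap.id ℝ (Matrix n n ℂ)) M (Φ : TDir d n M))) (j + 1) z)⁻¹)
          (cavgIter L (j + 1) (chart (ContinuousLinearMap.id ℝ (Matrix n n ℂ)) M Us (Φ : TDir d n M))) := by
    rw [hfac, gaugeAct_inv_gaugeAct]; rfl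
  have hSu : IsUnitaryCfg (strippedCfg L j Us (Φ : TDir d n M)) := by
    rw [hWS]; exact isUnitaryCfg_gaugeAct (isUnitarySite_inv hvU) hWu
  have hSP : IsPeriodicCfg (strippedCfg L j Us (Φ : TDir d n M)) (N : ℤ) := by
    rw [hWS]; exact isPeriodicCfg_gaugeAct (isPeriodicSite_inv hvP) hWP
  have hdecS : chart (ContinuousLinearMap.id ℝ (Matrix n n ℂ)) N V₀ ((strippedConstraint L N j Us Φ : ↥(skewSub d n N)) : TDir d n N)
      = strippedCfg L j Us (Φ : TDir d n M) := by
    unfold strippedConstraint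
    exact chart_skewPR_relLog_eq hV₀u hSu hV₀P hSP hSΦ
  rw [hdecG, hdecS]
  exact minAct_cavgIter_chart_eq_stripped hL hε j hsε Us (Φ : TDir d n M) hvU hvP

end

end Summit.QuantumFields.BalabanUV.T4Continuum.NE7StrippedConstraintMap
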